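import Summits.CriticalPhenomena.PercolationContinuityZ3.Theorems.SahiMasterFamilyGluedFramesTwoPure
import Summits.CriticalPhenomena.PercolationContinuityZ3.Theorems.SahiMasterFamilyGluedFramesConsistent

/-!
# Glued frames at order three, I: a core-free coordinate read by two glued frames (triples with a common pivotal coordinate)

Unit `prim-masterthm-p4` (gen 12; crux anchor stmt-CriticalPhenomena-4575, helper work; memo
`run/shared/lean/prim/prim-masterthm/prim-masterthm-p4/P4-GEN12-REPORT.md`).  Towards the tightness statement
`PositiveSomewhere.FaceVanishingCommonPivotalTight` (gen 11) and the weak positivity statement (P3+) `SahiE3PositiveSomewhere`.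

The glued-frame machinery of `prim-master-conj` (`GluedFrames.gframe`, `two_le_card_pure`, `faceFConsistent_of_noAbsorber`, …) is
order-free except for the final contradiction "a core-free coordinate lies in at most one glued block", which at order FOUR uses two members
outside the pair of readers (their `TwoReaders`, `W.card = 4`).  At order THREE that step is false in general (the triangle
`(x∨y, x∨z, y∨z)`), but it holds for triples with a COMMON PIVOTAL coordinate — the class of (P3+).  This file sets up the order-three reader
structure `CPReaders` (`W.card = 3`, plus a common pivotal coordinate) and re-derives, for it, the order-free witness calculus of the
order-four file (witnesses never share a coordinate, enlarge outside the deletion-face block, lie in the other reader's block; the two blocks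
cover `ι ∖ e`; the third member has trivial deletion-face frame; the readers are pure in the deletion face with frame `OR` of their block),
together with the cored-coordinate lemma (`not_mem_esupp_gframe_of_core'`).  Part II (`…CommonPivotalNoCoreFree`) finishes.
Adapted from prim-master-conj's order-four development (TIGHTNESS-III §7); pure combinatorics; axioms standard. [this work]
-/

noncomputable section

open scoped Classical

namespace Summit.CriticalPhenomena.PercolationContinuityZ3.Theorems

namespace PositiveSomewhere

open Finset Function GluedFrames
open Literature.Probability.LatticeModels.Kahn2022 (Affects)

variable {ι : Type*} [Fintype ι] {κ : Type*}

/-! ### Small facts about increasing events -/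

/-- A non-empty increasing event with empty essential support is everything. [folklore] -/
theorem eq_univ_of_esupp_eq_empty' {A : Set (Set ι)} (hA : IsUpperSet A) (hne : A.Nonempty) (h : esupp A = ∅) : A = Set.univ := by
  rcases eq_empty_or_univ_of_esupp_eq_empty hA h with h' | h'
  · exact absurd h' hne.ne_empty
  · exact h'

/-- `univ ∖ {x}` lies in an increasing event containing `univ` and not reading `x`. [folklore] -/
theorem univ_diff_mem_of_not_mem_esupp' {A : Set (Set ι)} (hA : IsUpperSet A) (huniv : Set.univ ∈ A) {x : ι} (hx : x ∉ esupp A) :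
    Set.univ \ {x} ∈ A := by
  refine (insert_mem_iff_of_not_affects hA (fun h => hx (mem_esupp.2 h)) _).1 ?_
  rwa [Set.insert_sdiff_singleton, Set.insert_eq_of_mem (Set.mem_univ x)]

/-- The event "some coordinate other than `e` is open" (`OR(ι ∖ e)`). [this work] -/
def orElse' (e : ι) : Set (Set ι) := {ω | ∃ y ∈ ω, y ≠ e}

omit [Fintype ι] in
/-- (auxiliary) membership in `orElse'`. [this work] -/
theorem mem_orElse' {e : ι} {ω : Set ι} : ω ∈ orElse' e ↔ ∃ y ∈ ω, y ≠ e := Iff.rfl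

omit [Fintype ι] in
/-- (auxiliary) `orElse'` is increasing. [this work] -/
theorem isUpperSet_orElse' (e : ι) : IsUpperSet (orElse' e) := fun _ _ hle ⟨y, hy, hye⟩ => ⟨y, hle hy, hye⟩

omit [Fintype ι] in
/-- (auxiliary) the non-members of `orElse' e` are the subsets of `{e}`. [this work] -/
theorem not_mem_orElse'_iff {e : ι} {ω : Set ι} : ω ∉ orElse' e ↔ ω ⊆ {e} := by
  rw [mem_orElse']; push Not
  exact ⟨fun h y hy => h y hy, fun h y hy => h hy⟩

omit [Fintype ι] in
/-- (auxiliary) `orElse' e` ignores `e`. [this work] -/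
theorem secAt_true_orElse' (e : ι) : secAt e true (orElse' e) = orElse' e := by
  ext ω
  rw [mem_secAt]; simp only [forceAt, cond_true, mem_orElse', Set.mem_insert_iff]
  constructor
  · rintro ⟨y, hy | hy, hye⟩
    · exact absurd hy hye
    · exact ⟨y, hy, hye⟩
  · rintro ⟨y, hy, hye⟩; exact ⟨y, Or.inr hy, hye⟩

/-- (auxiliary) every `y ≠ e` is essential for `orElse' e`. [this work] -/
theorem mem_esupp_orElse' {e y : ι} (hye : y ≠ e) : y ∈ esupp (orElse' e) :=
  mem_esupp.2 ⟨∅, by rintro ⟨z, hz, -⟩; exact hz, ⟨y, Set.mem_insert y ∅, hye⟩⟩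

/-- (auxiliary) `e` is not essential for `orElse' e`. [this work] -/
theorem not_mem_esupp_orElse'_self (e : ι) : e ∉ esupp (orElse' e) := by
  intro h
  have := not_affects_secAt e true (orElse' e)
  rw [secAt_true_orElse'] at this
  exact this (mem_esupp.1 h)

omit [Fintype ι] in
/-- An increasing event ignoring `e` and containing `orElse' e` is `orElse' e` or everything. [this work] -/
theorem eq_orElse'_or_univ {e : ι} {A : Set (Set ι)} (hA : IsUpperSet A) (hAe : secAt e true A = A) (hR : orElse' e ⊆ A) :
    A = orElse' e ∨ A = Set.univ := by
  by_cases h : ({e} : Set ι) ∈ A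
  · right
    have h0 : (∅ : Set ι) ∈ A := by
      rw [← hAe, mem_secAt]; simp only [forceAt, cond_true]
      rwa [show insert e (∅ : Set ι) = {e} from by ext; simp]
    exact Set.eq_univ_of_forall fun ω' => hA (Set.empty_subset ω') h0
  · left
    refine Set.Subset.antisymm (fun ω hω => ?_) hR
    by_contra hωR
    have hωe := not_mem_orElse'_iff.1 hωR
    exact h (hA hωe hω)

/-! ### Cored coordinates -/

/-- In a structured family a coordinate in the core of a member lies in that member's block. [this work] -/
theorem mem_esupp_cframe_of_core' (Φ : κ → Set (Set ι)) (hΦ : ∀ k, IsUpperSet (Φ k)) (hΦne : ∀ k, (Φ k).Nonempty) {W : Finset κ}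
    (hW : Structured Φ W) {l : κ} (hl : l ∈ W) {x : ι} (hcore : ∀ ω ∈ Φ l, x ∈ ω) : x ∈ esupp (cframe Φ W l) := by
  by_contra hx
  have hAu := isUpperSet_cframe Φ hΦ W l
  have huniv : ∀ m, Set.univ ∈ cframe Φ W m :=
    fun m => univ_mem_of_nonempty (isUpperSet_cframe Φ hΦ W m) ⟨_, subset_cframe Φ hΦ W m (univ_mem_of_nonempty (hΦ m) (hΦne m))⟩
  have hA : Set.univ \ {x} ∈ cframe Φ W l := univ_diff_mem_of_not_mem_esupp' hAu (huniv l) hx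
  have hU : Set.univ \ {x} ∉ Φ l := fun h => (hcore _ h).2 rfl
  have h2 := two_le_card_cfail_of_annihilator Φ hΦ hΦne hW hl hA hU
  obtain ⟨m, hm, m', hm', hmm⟩ := one_lt_card.1 (by omega : 1 < ((W.erase l).filter fun w => Set.univ \ {x} ∉ cframe Φ W w).card)
  rw [mem_filter] at hm hm'
  have hread : ∀ {m}, m ∈ W.erase l → Set.univ \ {x} ∉ cframe Φ W m → x ∈ esupp (cframe Φ W m) := by
    intro m _ hnot; by_contra hxm
    exact hnot (univ_diff_mem_of_not_mem_esupp' (isUpperSet_cframe Φ hΦ W m) (huniv m) hxm)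
  exact Finset.disjoint_left.1 (disjoint_esupp_cframe Φ hΦ hΦne hW (mem_of_mem_erase hm.1) (mem_of_mem_erase hm'.1) hmm)
    (hread hm.1 hm.2) (hread hm'.1 hm'.2)

variable (U : κ → Set (Set ι)) (W : Finset κ)

/-- `∅` lies in a glued frame iff every singleton does. [this work] -/
theorem empty_mem_gframe_of_singletons' (hU : ∀ k, IsUpperSet (U k)) (hne : ∀ k, (U k).Nonempty) (hS : ∀ h, Structured (faceT U h) W)
    {j : κ} (hj : j ∈ W) (h1 : ∀ h : ι, ({h} : Set ι) ∈ gframe U W j) : (∅ : Set ι) ∈ gframe U W j := by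
  rw [mem_gframe]; intro h
  rw [show insert h (∅ : Set ι) = {h} from by ext; simp]
  exact (mem_gframe_iff_of_mem U W hU hne hS hj (Set.mem_singleton h)).1 (h1 h)

/-- **A cored coordinate lies only in the glued block of its own member.** [this work] -/
theorem not_mem_esupp_gframe_of_core' (hU : ∀ k, IsUpperSet (U k)) (hne : ∀ k, (U k).Nonempty) (hS : ∀ h, Structured (faceT U h) W)
    {l j : κ} (hl : l ∈ W) (hj : j ∈ W) (hjl : j ≠ l) {x : ι} (hcore : ∀ ω ∈ U l, x ∈ ω) :
    x ∉ esupp (gframe U W j) := by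
  have key : ∀ ω : Set ι, ω ∉ gframe U W j → insert x ω ∈ gframe U W j → ∀ h ∈ ω, False := by
    intro ω hω hωx h hh
    have hhx : h ≠ x := by rintro rfl; exact hω (by rwa [Set.insert_eq_of_mem hh] at hωx)
    have hΦU := isUpperSet_faceT U hU h
    have hΦne := faceT_nonempty U hU hne h
    have hcore' : ∀ ω' ∈ faceT U h l, x ∈ ω' := by
      intro ω' hω'
      rw [faceT_apply, mem_secAt] at hω'
      simp only [forceAt, cond_true] at hω'
      rcases Set.mem_insert_iff.1 (hcore _ hω') with h1 | h1
      · exact absurd h1.symm hhx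
      · exact h1
    have hxl := mem_esupp_cframe_of_core' (faceT U h) hΦU hΦne (hS h) hl hcore'
    have hxj : x ∈ esupp (cframe (faceT U h) W j) := by
      rw [← secAt_true_gframe U W hU hne hS hj h, mem_esupp]
      refine ⟨ω, ?_, ?_⟩
      · rw [mem_secAt_true_iff_of_mem hh]; exact hω
      · rw [mem_secAt_true_iff_of_mem (Set.mem_insert_of_mem x hh)]; exact hωx
    exact Finset.disjoint_left.1 (disjoint_esupp_cframe (faceT U h) hΦU hΦne (hS h) hj hl hjl) hxj hxl
  intro hx
  obtain ⟨ω, hω, hωx⟩ := mem_esupp.1 hx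
  rcases Set.eq_empty_or_nonempty ω with rfl | ⟨h, hh⟩
  · rw [show insert x (∅ : Set ι) = {x} from by ext; simp] at hωx
    refine hω (empty_mem_gframe_of_singletons' U W hU hne hS hj fun h => ?_)
    by_cases hhx : h = x
    · subst hhx; exact hωx
    · by_contra hnot
      refine key {h} hnot (isUpperSet_gframe U W hU j ?_ hωx) h rfl
      intro y hy; rw [Set.mem_singleton_iff] at hy; subst hy; simp
  · exact key ω hω hωx h hh

/-! ### A core-free coordinate read by two glued frames, order three, with a common pivotal coordinate -/

section Readers

variable {U W}

/-- A (pivotality) WITNESS of `e` for the glued frame of `a`: an `e`-free non-empty configuration outside the frame whose `e`-enlargement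
is inside. [this work] -/
def CPWitness (U : κ → Set (Set ι)) (W : Finset κ) (e : ι) (a : κ) (ω : Set ι) : Prop :=
  ω.Nonempty ∧ e ∉ ω ∧ ω ∉ gframe U W a ∧ insert e ω ∈ gframe U W a

/-- Standing data (order three): a family of THREE non-empty non-sure increasing events with structured contraction faces and no member
containing the other two, a COMMON PIVOTAL coordinate, a core-free coordinate `e` with structured deletion face, and two distinct members
`a ≠ b` whose glued frames both read `e`.  (`…NoCoreFree` shows this is contradictory.) [this work] -/
structure CPReaders (U : κ → Set (Set ι)) (W : Finset κ) (e : ι) (a b : κ) : Prop where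
  hU : ∀ k, IsUpperSet (U k)
  hne : ∀ k, (U k).Nonempty
  hns : ∀ k, U k ≠ Set.univ
  hWU : ∀ k, k ∈ W
  hcard : W.card = 3
  hS : ∀ h, Structured (faceT U h) W
  habs : ∀ l ∈ W, ∃ m ∈ W, m ≠ l ∧ ¬ U m ⊆ U l
  hx : ∃ x : ι, ∀ k, Affects (U k) x
  he : CoreFree U e
  hF : Structured (faceF U e) W
  hab : a ≠ b
  ha : e ∈ esupp (gframe U W a)
  hb : e ∈ esupp (gframe U W b)

namespace CPReaders

variable {e : ι} {a b : κ} (D : CPReaders U W e a b)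
include D

/-- (auxiliary) symmetry in the two readers. [this work] -/
theorem symm : CPReaders U W e b a where
  hU := D.hU; hne := D.hne; hns := D.hns; hWU := D.hWU; hcard := D.hcard; hS := D.hS; habs := D.habs; hx := D.hx; he := D.he
  hF := D.hF; hab := D.hab.symm; ha := D.hb; hb := D.ha

/-- (auxiliary) the deletion face is increasing. [this work] -/
theorem hΦU : ∀ k, IsUpperSet (faceF U e k) := isUpperSet_faceF U D.hU e
/-- (auxiliary) the deletion face has non-empty members. [this work] -/
theorem hΦne : ∀ k, (faceF U e k).Nonempty := faceF_nonempty U D.he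

/-- The deletion-face frames ignore `e`. [this work] -/
theorem notMem_esupp_B (j : κ) : e ∉ esupp (cframe (faceF U e) W j) := by
  intro h
  have := not_affects_secAt e false (cframe (faceF U e) W j)
  rw [cframe_faceF_ignores U W D.hU D.he D.hF (D.hWU j)] at this
  exact this (mem_esupp.1 h)

/-- For `e`-free non-empty configurations, the glued frame and the deletion-face frame agree. [this work] -/
theorem mem_gframe_iff_mem_B {j : κ} {ω : Set ι} (hωne : ω.Nonempty) (heω : e ∉ ω) :
    ω ∈ gframe U W j ↔ ω ∈ cframe (faceF U e) W j := by
  obtain ⟨h, hh⟩ := hωne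
  have hhe : h ≠ e := fun he' => heω (he' ▸ hh)
  rw [mem_cframe_faceF_iff U W D.hU D.hne D.hS D.he D.hF (D.hWU j) hh hhe, mem_secAt_false_iff_of_notMem heω]

/-- A member whose glued frame reads `e` has a witness. [this work] -/
theorem exists_witness {c : κ} (hc : e ∈ esupp (gframe U W c)) : ∃ ω, CPWitness U W e c ω := by
  obtain ⟨ω, hω, hωe⟩ := mem_esupp.1 hc
  have heω : e ∉ ω := fun h => hω (by rwa [Set.insert_eq_of_mem h] at hωe)
  rcases Set.eq_empty_or_nonempty ω with rfl | hne'
  · rw [show insert e (∅ : Set ι) = {e} from by ext; simp] at hωe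
    obtain ⟨h, hhe, hh⟩ : ∃ h, h ≠ e ∧ ({h} : Set ι) ∉ gframe U W c := by
      by_contra hall
      push Not at hall
      refine hω (empty_mem_gframe_of_singletons' U W D.hU D.hne D.hS (D.hWU c) fun h => ?_)
      by_cases hhe : h = e
      · subst hhe; exact hωe
      · exact hall h hhe
    refine ⟨{h}, Set.singleton_nonempty h, fun h' => hhe (Set.mem_singleton_iff.1 h').symm, hh, ?_⟩
    exact isUpperSet_gframe U W D.hU c (by intro y hy; rw [Set.mem_singleton_iff] at hy; subst hy; simp) hωe
  · exact ⟨ω, hne', heω, hω, hωe⟩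

/-- Witnesses of the two readers never share a coordinate (block-disjointness in the contraction face there). [this work] -/
theorem witness_disjoint {ω ω' : Set ι} (hω : CPWitness U W e a ω) (hω' : CPWitness U W e b ω') {h : ι} (h1 : h ∈ ω) (h2 : h ∈ ω') :
    False := by
  have hΦU := isUpperSet_faceT U D.hU h
  have hΦne := faceT_nonempty U D.hU D.hne h
  have hreads : ∀ {c : κ} {χ : Set ι}, CPWitness U W e c χ → h ∈ χ → e ∈ esupp (cframe (faceT U h) W c) := by
    intro c χ hχ hh
    rw [← secAt_true_gframe U W D.hU D.hne D.hS (D.hWU c) h, mem_esupp]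
    refine ⟨χ, ?_, ?_⟩
    · rw [mem_secAt_true_iff_of_mem hh]; exact hχ.2.2.1
    · rw [mem_secAt_true_iff_of_mem (Set.mem_insert_of_mem e hh)]; exact hχ.2.2.2
  exact Finset.disjoint_left.1 (disjoint_esupp_cframe (faceT U h) hΦU hΦne (D.hS h) (D.hWU a) (D.hWU b) D.hab)
    (hreads hω h1) (hreads hω' h2)

/-- Enlarging a witness outside the block of its member (in the deletion face) gives a witness. [this work] -/
theorem witness_enlarge {c : κ} {ω : Set ι} (hω : CPWitness U W e c ω) :
    CPWitness U W e c (ω ∪ {y | y ∉ esupp (cframe (faceF U e) W c) ∧ y ≠ e}) := by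
  have hne' : (ω ∪ {y | y ∉ esupp (cframe (faceF U e) W c) ∧ y ≠ e}).Nonempty := hω.1.mono Set.subset_union_left
  have he' : e ∉ ω ∪ {y | y ∉ esupp (cframe (faceF U e) W c) ∧ y ≠ e} := by
    rintro (h | h)
    · exact hω.2.1 h
    · exact h.2 rfl
  refine ⟨hne', he', fun hmem => hω.2.2.1 ?_, isUpperSet_gframe U W D.hU c (Set.insert_subset_insert Set.subset_union_left) hω.2.2.2⟩
  rw [D.mem_gframe_iff_mem_B hω.1 hω.2.1]
  rw [D.mem_gframe_iff_mem_B hne' he'] at hmem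
  refine (mem_iff_of_inter_esupp_eq (isUpperSet_cframe (faceF U e) D.hΦU W c) ?_).2 hmem
  ext y; constructor
  · rintro ⟨hy, hys⟩; exact ⟨Or.inl hy, hys⟩
  · rintro ⟨hy | hy, hys⟩
    · exact ⟨hy, hys⟩
    · exact absurd (mem_coe.1 hys) hy.1

/-- Every witness of `a` lies inside the block of `b` (in the deletion face at `e`). [this work] -/
theorem witness_subset {ω : Set ι} (hω : CPWitness U W e a ω) : ω ⊆ ↑(esupp (cframe (faceF U e) W b)) := by
  obtain ⟨ω', hω'⟩ := D.symm.exists_witness D.hb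
  have hbig := D.symm.witness_enlarge hω'
  intro y hy
  by_contra hyS
  have hye : y ≠ e := fun h => hω.2.1 (h ▸ hy)
  exact D.witness_disjoint hω hbig hy (Or.inr ⟨hyS, hye⟩)

/-- The blocks of `a` and `b` in the deletion face cover every coordinate but `e`. [this work] -/
theorem mem_esupp_or {y : ι} (hye : y ≠ e) : y ∈ esupp (cframe (faceF U e) W a) ∨ y ∈ esupp (cframe (faceF U e) W b) := by
  by_contra hnot
  rw [not_or] at hnot
  obtain ⟨ω, hω⟩ := D.exists_witness D.ha
  obtain ⟨ω', hω'⟩ := D.symm.exists_witness D.hb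
  exact D.witness_disjoint (D.witness_enlarge hω) (D.symm.witness_enlarge hω') (h := y) (Or.inr ⟨hnot.1, hye⟩) (Or.inr ⟨hnot.2, hye⟩)

/-- The third member has the trivial frame in the deletion face. [this work] -/
theorem cframe_faceF_eq_univ {m : κ} (hma : m ≠ a) (hmb : m ≠ b) : cframe (faceF U e) W m = Set.univ := by
  refine eq_univ_of_esupp_eq_empty' (isUpperSet_cframe _ D.hΦU W m)
    ⟨_, subset_cframe _ D.hΦU W m (univ_mem_of_nonempty (D.hΦU m) (D.hΦne m))⟩ (eq_empty_of_forall_notMem fun y hy => ?_)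
  have hye : y ≠ e := fun h => D.notMem_esupp_B m (h ▸ hy)
  rcases D.mem_esupp_or hye with h | h
  · exact Finset.disjoint_left.1 (disjoint_esupp_cframe _ D.hΦU D.hΦne D.hF (D.hWU m) (D.hWU a) hma) hy h
  · exact Finset.disjoint_left.1 (disjoint_esupp_cframe _ D.hΦU D.hΦne D.hF (D.hWU m) (D.hWU b) hmb) hy h

/-- A deletion face of a non-sure event is not everything. [this work] -/
theorem faceF_ne_univ (m : κ) : faceF U e m ≠ Set.univ := by
  intro h
  have : (∅ : Set ι) ∈ faceF U e m := by rw [h]; exact Set.mem_univ _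
  rw [faceF_apply, mem_secAt] at this
  simp only [forceAt, cond_false, Set.empty_sdiff] at this
  exact D.hns m (Set.eq_univ_of_forall fun ω => D.hU m (Set.empty_subset ω) this)

/-- `a` is pure in the deletion face: its frame there is the member. [this work] -/
theorem cframe_faceF_a : cframe (faceF U e) W a = faceF U e a := by
  obtain ⟨p, hp, q, hq, hpq, hfp, hfq⟩ := exists_two_pure (faceF U e) D.hΦU D.hΦne D.hF (by rw [D.hcard]; norm_num)
  have key : ∀ {m}, cframe (faceF U e) W m = faceF U e m → m = a ∨ m = b := by
    intro m hm
    by_contra h; rw [not_or] at h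
    exact D.faceF_ne_univ m (by rw [← hm]; exact D.cframe_faceF_eq_univ h.1 h.2)
  rcases key hfp with rfl | rfl
  · exact hfp
  · rcases key hfq with rfl | hqb
    · exact hfq
    · exact absurd hqb.symm (by rintro rfl; exact hpq rfl)

/-- The frame of `a` in the deletion face is `OR` of its block. [this work] -/
theorem mem_cframe_faceF_a_iff (ω : Set ι) :
    ω ∈ cframe (faceF U e) W a ↔ ∃ y ∈ ω, y ∈ esupp (cframe (faceF U e) W a) := by
  obtain ⟨ωa, hωa⟩ := D.exists_witness D.ha
  have hBa := isUpperSet_cframe (faceF U e) D.hΦU W a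
  have hωaS : ∀ y ∈ ωa, y ∉ esupp (cframe (faceF U e) W a) := fun y hy hyS =>
    Finset.disjoint_left.1 (disjoint_esupp_cframe _ D.hΦU D.hΦne D.hF (D.hWU a) (D.hWU b) D.hab) hyS (D.witness_subset hωa hy)
  have hωaB : ωa ∉ cframe (faceF U e) W a := fun h => hωa.2.2.1 ((D.mem_gframe_iff_mem_B hωa.1 hωa.2.1).2 h)
  constructor
  · intro hω
    by_contra hnone
    push Not at hnone
    apply hωaB
    refine (mem_iff_of_inter_esupp_eq hBa (ω := ωa) (ω' := ω) ?_).2 hω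
    ext y; constructor
    · rintro ⟨hy, hys⟩; exact absurd (mem_coe.1 hys) (hωaS y hy)
    · rintro ⟨hy, hys⟩; exact absurd (mem_coe.1 hys) (hnone y hy)
  · rintro ⟨y, hy, hyS⟩
    set ω' : Set ι := ωa ∪ (ω ∩ ↑(esupp (cframe (faceF U e) W a))) with hω'def
    have hne' : ω'.Nonempty := hωa.1.mono Set.subset_union_left
    have he' : e ∉ ω' := by
      rintro (h | ⟨-, h⟩)
      · exact hωa.2.1 h
      · exact D.notMem_esupp_B a (mem_coe.1 h)
    have hω'G : ω' ∈ gframe U W a := by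
      by_contra hnot
      have hw : CPWitness U W e a ω' :=
        ⟨hne', he', hnot, isUpperSet_gframe U W D.hU a (Set.insert_subset_insert Set.subset_union_left) hωa.2.2.2⟩
      have := D.witness_subset hw (Or.inr ⟨hy, mem_coe.2 hyS⟩)
      exact Finset.disjoint_left.1 (disjoint_esupp_cframe _ D.hΦU D.hΦne D.hF (D.hWU a) (D.hWU b) D.hab) hyS (mem_coe.1 this)
    have hω'B := (D.mem_gframe_iff_mem_B hne' he').1 hω'G
    refine (mem_iff_of_inter_esupp_eq hBa (ω := ω) (ω' := ω') ?_).2 hω'B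
    ext z; constructor
    · rintro ⟨hz, hzs⟩; exact ⟨Or.inr ⟨hz, hzs⟩, hzs⟩
    · rintro ⟨hz | ⟨hz, -⟩, hzs⟩
      · exact absurd (mem_coe.1 hzs) (hωaS z hz)
      · exact ⟨hz, hzs⟩

/-- The block of `a` in the deletion face is non-empty. [this work] -/
theorem esupp_cframe_faceF_a_nonempty : (esupp (cframe (faceF U e) W a)).Nonempty := by
  by_contra h
  rw [not_nonempty_iff_eq_empty] at h
  have := eq_univ_of_esupp_eq_empty' (isUpperSet_cframe _ D.hΦU W a)
    ⟨_, subset_cframe _ D.hΦU W a (univ_mem_of_nonempty (D.hΦU a) (D.hΦne a))⟩ h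
  exact D.faceF_ne_univ a (by rw [← D.cframe_faceF_a]; exact this)

end CPReaders

end Readers

end PositiveSomewhere

end Summit.CriticalPhenomena.PercolationContinuityZ3.Theorems
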